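import Mathlib
import Literature.MathematicalPhysics.QuantumFieldTheory.Balaban1983to89.Beta.PolarizationLimit

/-!
# `Balaban1983to89.Beta.PolarizationWitness` — a NON-VACUITY and SHARPNESS WITNESS for the hypotheses of the
# β sub-cell's sign lemma, torus side: Gram kernels are PSD and index-symmetric, divergence-free rows give the Ward
# identity, reflection-covariant rows give reflection covariance; the tree-level lattice Maxwell kernel (Gram kernel of
# the plaquette curl) has all four properties on every torus `(ZMod s)^d`, and its second moment is `β_T = 2 > 0`

T. Bałaban, *Renormalization group approach to lattice gauge field theories. I. Generation of effective actions in a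
small field approximation and a coupling constant renormalization in four dimensions*, Commun. Math. Phys. **109**,
249–301 (1987) [Balaban1987RG1] (cell paper B12; PDF page = journal page − 248; PDF held:
`paper:balaban1987-cmp109-rg-i-small-field`).

HONEST FRAMING (BETA-SPEC.md, verbatim): discharging `BetaPertH` makes Bałaban's UV stability UNCONDITIONAL — a real
constructive-QFT result; it is NOT the continuum limit and NOT the Clay problem.  THIS MODULE DISCHARGES NOTHING of the
series.  It is KERNEL-CHECKED BOOKKEEPING (unit `b2b-balaban-pv09` gen 3, journal node `BETA-an2-LEMMA52-WITNESS-KERNEL`,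
the follow-up (k5) of nodes (k3) = `Beta/PolarizationSign.lean` and (k4) = `Beta/PolarizationLimit.lean`): finite
algebra on the discrete torus.  Value = a certificate that the hypothesis set of the sign lemma is jointly satisfiable
by a non-zero kernel with STRICTLY positive second moment (so `β ≥ 0` there is neither vacuous nor `β = 0` in disguise),
plus a certified test kernel for row num — NOT summit progress.

CITATION HEADER (lean-in-tree rule 2026-08-18).  NO NEW QUOTATION is introduced by this module, and NOTHING PRINTED IS
ASSERTED.  The printed sentences it is ABOUT — (5.7) reflection covariance, (5.8) index symmetry, (5.9) transversality
(Ward identity), (5.10) decay, p. 293 [PDF 45] of [Balaban1987RG1], and (1.22) p. 264 [PDF 16] (the second moment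
`Σ_x Π_{μν}(x) x_μ x_ν`, `μ ≠ ν`) — are quoted verbatim in the header of `Beta/PolarizationSign.lean` (node (k3),
p178805) and typed there / in `Beta/PolarizationLimit.lean` (node (k4), p178996) as the torus-side PREDICATES
`TorusAxisReflectionCovariant`, `TorusIndexSymmetric`, `TorusWardTransversal`, `TorusConvPSD` and pv25's
`torusSecondMoment` (`Beta/OneLoop.lean`), all used here BY NAME.  The objects introduced below (Kronecker delta,
forward difference, plaquette-curl incidence, its Gram kernel = the quadratic form `Σ_plaquettes (∂_κA_λ − ∂_λA_κ)²` of
free lattice `U(1)`/tree-level Yang–Mills theory) are FOLKLORE lattice calculus, defined here from scratch and tagged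
`[folklore]`; that this Gram kernel is "the `g → 0` term of Bałaban's `Π_{μν}(g_k,·)`" is CONTEXT from the β sub-cell's
notes (`HOME/BETA/AN2-pv09.md` §9, `HOME/BETA/AN2.md` §4 — programme-internal prose, NOT cited as a source of facts,
cell rule) and is NOT asserted or used: the theorems below are unconditional identities about an explicitly defined
kernel.

WHAT IS PROVED (0 sorry; Mathlib + the cell modules imported, all by name):
(1) §1 GRAM KERNELS on the torus `(ZMod s)^d` (`Beta.Site d s`, pv25): for any incidence tensor
    `a : ι → Fin d → Site d s → ℝ` (finite row type `ι`), `gramKernel a μ ν z = Σ_u Σ_ρ a_{ρμ}(u) a_{ρν}(u + z)` is the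
    convolution kernel of `T*T` for `(T f)_ρ(w) = Σ_x Σ_μ a_{ρμ}(w − x) f_μ(x)` (`incApply`, `gram_shift`); the torus
    form is a sum of squares (`torusForm_gram`: `Σ f P f = Σ_w Σ_ρ (Tf)_ρ(w)²`), hence `torusConvPSD_gram :
    TorusConvPSD (gramKernel a)`; and `torusIndexSymmetric_gram : TorusIndexSymmetric (gramKernel a)` — for EVERY `a`.
(2) §2 `torusWardTransversal_gram`: divergence-free rows (`DivFree a`: `Σ_μ [a_{ρμ}(u + ê_μ) − a_{ρμ}(u)] = 0`) ⇒
    `TorusWardTransversal (gramKernel a)`.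
(3) §3 `torusAxisReflectionCovariant_gram`: row covariance under each axis reflection `ε` (`RowReflCovariant a`:
    `a_{ρμ}(εu + c_ρ + [μ=α]ê_α) = ε_μ σ_ρ a_{ρμ}(u)` with row signs `σ_ρ² = 1` and row shifts `c_ρ`) ⇒
    `TorusAxisReflectionCovariant (gramKernel a)` (substitution `u ↦ εu + c_ρ + [μ=α]ê_α`, a permutation of the torus).
(4) §4 THE PLAQUETTE CURL: `delta0`, `fwdDelta κ` (kernel of the forward derivative, `sum_fwdDelta_sub_mul`), the
    incidence `curlInc (κ,λ) μ u = [μ=λ]D_κ(u) − [μ=κ]D_λ(u)` with `incApply_curlInc : (T A)_{(κ,λ)}(w) =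
    [A_λ(w+ê_κ) − A_λ(w)] − [A_κ(w+ê_λ) − A_κ(w)]`, `maxwellKernel d s := gramKernel curlInc`; `divFree_curlInc`
    (`∂_κ∂_λ = ∂_λ∂_κ`), `rowReflCovariant_curlInc` (row sign `ε_κε_λ`, row shift `−[κ=α]ê_α − [λ=α]ê_α`; the key
    step `fwdDelta_reflect : D_κ(εu − [κ=α]ê_α) = ε_κ D_κ(u)` — a forward difference along the reflected axis
    reflects into MINUS the forward difference at the shifted site, the bond-reversal behind (5.7)), and
    `maxwellKernel_hypotheses : TorusWardTransversal ∧ TorusAxisReflectionCovariant ∧ TorusIndexSymmetric ∧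
    TorusConvPSD` of `maxwellKernel d s`, for EVERY dimension `d` and EVERY period `s ≥ 1`.
(5) §5 CLOSED FORM AND SECOND MOMENT: `maxwellKernel_apply : Π_{μν}(z) = 2([μ=ν] Σ_κ C_{κκ}(z) − C_{νμ}(z))` with
    `C_{νμ}(z) = Σ_u D_ν(u)D_μ(u+z) = δ(z+ê_μ−ê_ν) − δ(z−ê_ν) − δ(z+ê_μ) + δ(z)` (`ddCorr`, `sum_fwdDelta_mul_fwdDelta`)
    — the `−Δδ_{μν} + ∂_μ∂_ν^*` structure of the free lattice Maxwell operator (times `2`: both orderings of each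
    plaquette are rows); `maxwellKernel_offdiag_closed`; and `torusSecondMoment_maxwellKernel : torusSecondMoment
    (maxwellKernel d s) μ ν = 2` for `μ ≠ ν`, `s ≥ 3` (window representatives `symmRep`, pv25/pv01: only
    `z = ê_ν − ê_μ` contributes, `z_μ z_ν = (−1)(+1)`, weight `−2`).
CONSEQUENCE (read together with (k3)/(k4), nothing further formalised here): the torus-side hypothesis quadruple of
`PolarizationLimit.secondMoment_nonneg_of_limit` / `Beta.OneLoopDictionary.beta0_nonneg_of_torus` is satisfiable —
simultaneously, on every torus, by one explicit finite-range kernel — with torus second moment exactly `2`; the sign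
conclusion of the β sub-cell's "Lemma 5.2"-type statement is therefore attained strictly by an admissible kernel.
SCOPE.  (a) Whether BAŁABAN's one-loop torus kernels `torusKernel (D.model k t) a` satisfy the four predicates is the β
sub-cell's analysis (AN2 §8.7 Ward per gauge-invariant piece, `Beta/WardIdentity.lean`; PSD, `Beta/LogDetVariation.lean`;
Euclidean covariance of the construction, (2.17) p. 269) — untouched here.  (b) The `ℤ^d` side (an explicit `ℤ^d`
Maxwell kernel as the `IsInfiniteVolumeLimit` of `t ↦ maxwellKernel d (side t)` with `UniformDecay`, making the FULL
hypothesis list of `secondMoment_nonneg_of_limit` hold at once) is finite-range bookkeeping through pv01's window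
dictionary and is NOT done in this node (recorded as the natural follow-up in `HOME/GAPS.md`).  (c) No claim about
`β⁰_k`, (AF-0), `BetaPertH` or G1 is made or implied.
-/

namespace Literature.MathematicalPhysics.QuantumFieldTheory.Balaban1983to89.Beta.PolarizationWitness

open Literature.MathematicalPhysics.QuantumFieldTheory.Balaban1983to89
open Literature.MathematicalPhysics.QuantumFieldTheory.Balaban1983to89.Beta
open Literature.MathematicalPhysics.QuantumFieldTheory.Balaban1983to89.Beta.PolarizationSign
open Literature.MathematicalPhysics.QuantumFieldTheory.Balaban1983to89.Beta.PolarizationLimit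

variable {d s : ℕ} {ι : Type*} [Fintype ι]

/-! ## §0 The axis reflection `ε` of the torus -/

/-- `ε` is additive. [folklore] -/
theorem torusAxisReflect_add (α : Fin d) (u v : Beta.Site d s) :
    torusAxisReflect α (u + v) = torusAxisReflect α u + torusAxisReflect α v := by
  funext i; by_cases h : i = α <;> simp [h]; ring

/-- `ε` is an involution. [folklore] -/
theorem torusAxisReflect_torusAxisReflect (α : Fin d) (u : Beta.Site d s) :
    torusAxisReflect α (torusAxisReflect α u) = u := by
  funext i; by_cases h : i = α <;> simp [h]

/-- `ε` as a permutation of the torus. [folklore] -/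
def reflEquiv (α : Fin d) : Beta.Site d s ≃ Beta.Site d s where
  toFun := torusAxisReflect α
  invFun := torusAxisReflect α
  left_inv := torusAxisReflect_torusAxisReflect α
  right_inv := torusAxisReflect_torusAxisReflect α

/-- `ε` fixes the origin. [folklore] -/
theorem torusAxisReflect_zero (α : Fin d) : torusAxisReflect α (0 : Beta.Site d s) = 0 := by
  funext i; by_cases h : i = α <;> simp [h]

/-- `ε` commutes with negation. [folklore] -/
theorem torusAxisReflect_neg (α : Fin d) (u : Beta.Site d s) :
    torusAxisReflect α (-u) = -torusAxisReflect α u := by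
  funext i; by_cases h : i = α <;> simp [h]

/-- `ε` commutes with subtraction. [folklore] -/
theorem torusAxisReflect_sub (α : Fin d) (u v : Beta.Site d s) :
    torusAxisReflect α (u - v) = torusAxisReflect α u - torusAxisReflect α v := by
  rw [sub_eq_add_neg, torusAxisReflect_add, torusAxisReflect_neg, ← sub_eq_add_neg]

/-- `ε ê_α = −ê_α`. [folklore] -/
theorem torusAxisReflect_torusUnitVec_self (α : Fin d) :
    torusAxisReflect α (torusUnitVec α : Beta.Site d s) = -torusUnitVec α := by
  funext i; by_cases h : i = α <;> simp [h]

/-- `ε ê_κ = ê_κ` for `κ ≠ α`. [folklore] -/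
theorem torusAxisReflect_torusUnitVec_ne {α κ : Fin d} (h : κ ≠ α) :
    torusAxisReflect α (torusUnitVec κ : Beta.Site d s) = torusUnitVec κ := by
  funext i; by_cases hi : i = α
  · subst hi; simp [Ne.symm h]
  · simp [hi]

/-- `ε u = 0 ↔ u = 0`. [folklore] -/
theorem torusAxisReflect_eq_zero_iff (α : Fin d) (u : Beta.Site d s) : torusAxisReflect α u = 0 ↔ u = 0 := by
  constructor
  · intro h
    have h' := congrArg (torusAxisReflect α) h
    rwa [torusAxisReflect_torusAxisReflect, torusAxisReflect_zero] at h'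
  · rintro rfl; exact torusAxisReflect_zero α

/-- `ε_α = −1`. [folklore] -/
theorem reflSign_self (α : Fin d) : reflSign α α = -1 := by simp [reflSign]

/-- `ε_κ = 1` for `κ ≠ α`. [folklore] -/
theorem reflSign_of_ne {α κ : Fin d} (h : κ ≠ α) : reflSign α κ = 1 := by simp [reflSign, h]

/-- `ε_κ² = 1`. [folklore] -/
theorem reflSign_mul_self (α κ : Fin d) : reflSign α κ * reflSign α κ = 1 := by
  unfold reflSign; split_ifs <;> norm_num

variable [NeZero s]

/-! ## §1 Gram kernels on the torus `(ZMod s)^d` -/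

/-- The GRAM KERNEL of an incidence tensor `a : ι → Fin d → Site d s → ℝ` (row index `ρ : ι`, bond direction `μ`,
relative site `u`): `P_{μν}(z) = Σ_u Σ_ρ a_{ρμ}(u) a_{ρν}(u + z)` — the convolution kernel of `T*T` for the
translation-invariant operator `(T f)_ρ(w) = Σ_x Σ_μ a_{ρμ}(w − x) f_μ(x)` (`incApply`). [folklore] -/
def gramKernel (a : ι → Fin d → Beta.Site d s → ℝ) : Fin d → Fin d → Beta.Site d s → ℝ :=
  fun μ ν z => ∑ u, ∑ ρ, a ρ μ u * a ρ ν (u + z)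

/-- The translation-invariant operator `(T f)_ρ(w) = Σ_x Σ_μ a_{ρμ}(w − x) f_μ(x)` of an incidence tensor.
[folklore] -/
def incApply (a : ι → Fin d → Beta.Site d s → ℝ) (f : Beta.Site d s → Fin d → ℝ) (w : Beta.Site d s) (ρ : ι) : ℝ :=
  ∑ x, ∑ μ, a ρ μ (w - x) * f x μ

/-- `(T*T)` has convolution kernel the Gram kernel: `Σ_w Σ_ρ a_{ρμ}(w − x) a_{ρν}(w − y) = P_{μν}(x − y)`
(substitution `w = u + x` on the torus). [folklore] -/
theorem gram_shift (a : ι → Fin d → Beta.Site d s → ℝ) (μ ν : Fin d) (x y : Beta.Site d s) :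
    ∑ w, ∑ ρ, a ρ μ (w - x) * a ρ ν (w - y) = gramKernel a μ ν (x - y) := by
  unfold gramKernel
  rw [← Equiv.sum_comp (Equiv.addRight x)]
  refine Finset.sum_congr rfl fun u _ => Finset.sum_congr rfl fun ρ _ => ?_
  simp only [Equiv.coe_addRight, add_sub_cancel_right, add_sub_assoc]

/-- Rearrangement: a sum of products over a common last index is the sum of the products of the partial sums.
[folklore] -/
theorem sum_sum_sum_mul {α β γ : Type*} [Fintype α] [Fintype β] [Fintype γ] (Φ : α → γ → ℝ) (Ψ : β → γ → ℝ) :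
    ∑ p, ∑ q, ∑ r, Φ p r * Ψ q r = ∑ r, (∑ p, Φ p r) * (∑ q, Ψ q r) := by
  calc ∑ p, ∑ q, ∑ r, Φ p r * Ψ q r = ∑ p, ∑ r, ∑ q, Φ p r * Ψ q r :=
        Finset.sum_congr rfl fun p _ => Finset.sum_comm
    _ = ∑ r, ∑ p, ∑ q, Φ p r * Ψ q r := Finset.sum_comm
    _ = ∑ r, (∑ p, Φ p r) * (∑ q, Ψ q r) :=
        Finset.sum_congr rfl fun r _ => by rw [Finset.sum_mul_sum]

/-- The same with doubled binders `(x, μ)`, `(y, ν)`. [folklore] -/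
theorem sum6_mul {γ : Type*} [Fintype γ] (Φ Ψ : Beta.Site d s → Fin d → γ → ℝ) :
    ∑ x, ∑ μ, ∑ y, ∑ ν, ∑ r, Φ x μ r * Ψ y ν r = ∑ r, (∑ x, ∑ μ, Φ x μ r) * (∑ y, ∑ ν, Ψ y ν r) := by
  have h := sum_sum_sum_mul (fun p : Beta.Site d s × Fin d => fun r => Φ p.1 p.2 r)
    (fun q : Beta.Site d s × Fin d => fun r => Ψ q.1 q.2 r)
  simpa only [Fintype.sum_prod_type] using h

/-- **THE TORUS FORM OF A GRAM KERNEL IS A SUM OF SQUARES**: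
`Σ_{x,y} Σ_{μν} f_μ(x) P_{μν}(x − y) f_ν(y) = Σ_w Σ_ρ (T f)_ρ(w)²`. [folklore] -/
theorem torusForm_gram (a : ι → Fin d → Beta.Site d s → ℝ) (f : Beta.Site d s → Fin d → ℝ) :
    ∑ x, ∑ y, ∑ μ, ∑ ν, f x μ * gramKernel a μ ν (x - y) * f y ν = ∑ w, ∑ ρ, (incApply a f w ρ) ^ 2 := by
  have hA : ∑ x, ∑ y, ∑ μ, ∑ ν, f x μ * gramKernel a μ ν (x - y) * f y ν
      = ∑ x, ∑ μ, ∑ y, ∑ ν, ∑ r : Beta.Site d s × ι,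
          (a r.2 μ (r.1 - x) * f x μ) * (a r.2 ν (r.1 - y) * f y ν) := by
    calc ∑ x, ∑ y, ∑ μ, ∑ ν, f x μ * gramKernel a μ ν (x - y) * f y ν
        = ∑ x, ∑ μ, ∑ y, ∑ ν, f x μ * gramKernel a μ ν (x - y) * f y ν :=
          Finset.sum_congr rfl fun x _ => Finset.sum_comm
      _ = _ := by
          refine Finset.sum_congr rfl fun x _ => Finset.sum_congr rfl fun μ _ =>
            Finset.sum_congr rfl fun y _ => Finset.sum_congr rfl fun ν _ => ?_
          rw [← gram_shift, Fintype.sum_prod_type, Finset.mul_sum, Finset.sum_mul]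
          refine Finset.sum_congr rfl fun w _ => ?_
          rw [Finset.mul_sum, Finset.sum_mul]
          exact Finset.sum_congr rfl fun ρ _ => by dsimp only; ring
  rw [hA, sum6_mul, Fintype.sum_prod_type]
  refine Finset.sum_congr rfl fun w _ => Finset.sum_congr rfl fun ρ _ => ?_
  simp only [incApply, sq]

/-- **EVERY GRAM KERNEL IS TORUS-PSD** (`TorusConvPSD`, the hypothesis of (k3)/(k4)). [folklore] -/
theorem torusConvPSD_gram (a : ι → Fin d → Beta.Site d s → ℝ) : TorusConvPSD (gramKernel a) := by
  intro f
  rw [torusForm_gram]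
  positivity

/-- **EVERY GRAM KERNEL IS INDEX-SYMMETRIC** ((5.8)-shape, `TorusIndexSymmetric`). [folklore] -/
theorem torusIndexSymmetric_gram (a : ι → Fin d → Beta.Site d s → ℝ) : TorusIndexSymmetric (gramKernel a) := by
  intro μ ν x
  unfold gramKernel
  symm
  rw [← Equiv.sum_comp (Equiv.addRight x)]
  refine Finset.sum_congr rfl fun u _ => Finset.sum_congr rfl fun ρ _ => ?_
  simp only [Equiv.coe_addRight, add_neg_cancel_right]
  ring

/-! ## §2 Divergence-free rows ⇒ the torus Ward identity -/

/-- The rows of the incidence tensor are (forward-)divergence free: `Σ_μ [a_{ρμ}(u + ê_μ) − a_{ρμ}(u)] = 0`.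
[folklore] -/
def DivFree (a : ι → Fin d → Beta.Site d s → ℝ) : Prop :=
  ∀ ρ u, ∑ μ, (a ρ μ (u + torusUnitVec μ) - a ρ μ u) = 0

/-- **DIVERGENCE-FREE ROWS ⇒ TORUS WARD IDENTITY** ((5.9)-shape, `TorusWardTransversal`). [folklore] -/
theorem torusWardTransversal_gram {a : ι → Fin d → Beta.Site d s → ℝ} (h : DivFree a) :
    TorusWardTransversal (gramKernel a) := by
  intro ν x
  have key : ∀ μ, gramKernel a μ ν (x - torusUnitVec μ)
      = ∑ u, ∑ ρ, a ρ μ (u + torusUnitVec μ) * a ρ ν (u + x) := by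
    intro μ
    unfold gramKernel
    rw [← Equiv.sum_comp (Equiv.addRight (torusUnitVec μ : Beta.Site d s))]
    refine Finset.sum_congr rfl fun u _ => Finset.sum_congr rfl fun ρ _ => ?_
    simp only [Equiv.coe_addRight]
    congr 2
    abel
  simp_rw [key]
  unfold gramKernel
  calc ∑ μ, (∑ u, ∑ ρ, a ρ μ (u + torusUnitVec μ) * a ρ ν (u + x) - ∑ u, ∑ ρ, a ρ μ u * a ρ ν (u + x))
      = ∑ μ, ∑ u, ∑ ρ, (a ρ μ (u + torusUnitVec μ) - a ρ μ u) * a ρ ν (u + x) := by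
        refine Finset.sum_congr rfl fun μ _ => ?_
        rw [← Finset.sum_sub_distrib]
        refine Finset.sum_congr rfl fun u _ => ?_
        rw [← Finset.sum_sub_distrib]
        exact Finset.sum_congr rfl fun ρ _ => by ring
    _ = ∑ u, ∑ ρ, (∑ μ, (a ρ μ (u + torusUnitVec μ) - a ρ μ u)) * a ρ ν (u + x) := by
        rw [Finset.sum_comm]
        refine Finset.sum_congr rfl fun u _ => ?_
        rw [Finset.sum_comm]
        exact Finset.sum_congr rfl fun ρ _ => by rw [Finset.sum_mul]
    _ = 0 := by simp [h _ _]

/-! ## §3 Reflection-covariant rows ⇒ torus reflection covariance -/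

/-- ROW COVARIANCE under the reflection of axis `α`: each row `ρ` transforms into itself up to a sign `σ_ρ = ±1` and
a shift `c_ρ`, with the bond sign `ε_μ` and the bond shift `[μ = α]ê_α` of a reflected bond:
`a_{ρμ}(εu + c_ρ + [μ=α]ê_α) = ε_μ σ_ρ a_{ρμ}(u)`. [folklore] -/
def RowReflCovariant (a : ι → Fin d → Beta.Site d s → ℝ) : Prop :=
  ∀ α, ∃ (c : ι → Beta.Site d s) (σ : ι → ℝ), (∀ ρ, σ ρ * σ ρ = 1) ∧
    ∀ ρ μ u, a ρ μ (torusAxisReflect α u + c ρ + (if μ = α then torusUnitVec α else 0))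
      = reflSign α μ * σ ρ * a ρ μ u

/-- **ROW-COVARIANT INCIDENCE ⇒ TORUS REFLECTION COVARIANCE OF THE GRAM KERNEL** ((5.7)–(5.8)-shape,
`TorusAxisReflectionCovariant`). [folklore] -/
theorem torusAxisReflectionCovariant_gram {a : ι → Fin d → Beta.Site d s → ℝ} (h : RowReflCovariant a) :
    TorusAxisReflectionCovariant (gramKernel a) := by
  intro α μ ν z
  obtain ⟨c, σ, hσ, hcov⟩ := h α
  unfold gramKernel
  rw [Finset.sum_comm]
  conv_rhs => rw [Finset.sum_comm, Finset.mul_sum]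
  refine Finset.sum_congr rfl fun ρ _ => ?_
  rw [Finset.mul_sum]
  -- substitute u = ε u' + c ρ + [μ=α]ê_α
  rw [← Equiv.sum_comp ((reflEquiv α).trans
    (Equiv.addRight (c ρ + (if μ = α then torusUnitVec α else 0) : Beta.Site d s)))]
  refine Finset.sum_congr rfl fun u _ => ?_
  have h1 : ((reflEquiv α).trans (Equiv.addRight (c ρ + (if μ = α then torusUnitVec α else 0)))) u
      = torusAxisReflect α u + c ρ + (if μ = α then torusUnitVec α else 0) := by
    simp [reflEquiv, add_assoc]
  have h2 : torusAxisReflect α u + c ρ + (if μ = α then torusUnitVec α else 0)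
        + (torusAxisReflect α z - (if μ = α then torusUnitVec α else 0)
            + (if ν = α then torusUnitVec α else 0))
      = torusAxisReflect α (u + z) + c ρ + (if ν = α then torusUnitVec α else 0) := by
    rw [torusAxisReflect_add]; abel
  rw [h1, h2, hcov ρ μ u, hcov ρ ν (u + z)]
  have h3 : σ ρ * σ ρ = 1 := hσ ρ
  calc reflSign α μ * σ ρ * a ρ μ u * (reflSign α ν * σ ρ * a ρ ν (u + z))
      = reflSign α μ * reflSign α ν * (σ ρ * σ ρ) * (a ρ μ u * a ρ ν (u + z)) := by ring
    _ = reflSign α μ * reflSign α ν * (a ρ μ u * a ρ ν (u + z)) := by rw [h3, mul_one]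

/-! ## §4 The plaquette-curl incidence and the tree-level lattice Maxwell kernel -/

/-- Kronecker delta at the origin of the torus. [folklore] -/
def delta0 (u : Beta.Site d s) : ℝ := if u = 0 then 1 else 0

omit [NeZero s] in
/-- `δ` is reflection invariant. [folklore] -/
theorem delta0_torusAxisReflect (α : Fin d) (u : Beta.Site d s) :
    delta0 (torusAxisReflect α u) = delta0 u := by
  simp [delta0, torusAxisReflect_eq_zero_iff]

/-- `Σ_u δ(u + v) g(u) = g(−v)`. [folklore] -/
theorem sum_delta0_add_mul (v : Beta.Site d s) (g : Beta.Site d s → ℝ) :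
    ∑ u, delta0 (u + v) * g u = g (-v) := by
  simp [delta0, add_eq_zero_iff_eq_neg, Finset.sum_ite_eq']

/-- `Σ_u δ(u − v) g(u) = g(v)`. [folklore] -/
theorem sum_delta0_sub_mul (v : Beta.Site d s) (g : Beta.Site d s → ℝ) :
    ∑ u, delta0 (u - v) * g u = g v := by
  simp [delta0, sub_eq_zero, Finset.sum_ite_eq']

/-- The convolution kernel of the FORWARD LATTICE DERIVATIVE `(∂_κ f)(w) = f(w + ê_κ) − f(w) = Σ_x D_κ(w − x) f(x)`:
`D_κ(u) = δ(u + ê_κ) − δ(u)`. [folklore] -/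
def fwdDelta (κ : Fin d) (u : Beta.Site d s) : ℝ := delta0 (u + torusUnitVec κ) - delta0 u

/-- `Σ_x D_κ(w − x) f(x) = f(w + ê_κ) − f(w)`. [folklore] -/
theorem sum_fwdDelta_sub_mul (κ : Fin d) (w : Beta.Site d s) (g : Beta.Site d s → ℝ) :
    ∑ x, fwdDelta κ (w - x) * g x = g (w + torusUnitVec κ) - g w := by
  simp only [fwdDelta, sub_mul, Finset.sum_sub_distrib]
  rw [← Equiv.sum_comp (Equiv.neg (Beta.Site d s)), ← Equiv.sum_comp (Equiv.neg (Beta.Site d s)) (fun x => delta0 (w - x) * g x)]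
  simp only [Equiv.neg_apply, sub_neg_eq_add]
  rw [show (fun u : Beta.Site d s => delta0 (w + u + torusUnitVec κ) * g (-u))
      = fun u => delta0 (u + (w + torusUnitVec κ)) * g (-u) from by funext u; congr 2; abel,
    sum_delta0_add_mul, show (fun u : Beta.Site d s => delta0 (w + u) * g (-u))
      = fun u => delta0 (u + w) * g (-u) from by funext u; rw [add_comm], sum_delta0_add_mul]
  simp only [neg_neg]

omit [NeZero s] in
/-- REFLECTION OF THE FORWARD DIFFERENCE, off the reflected axis: `D_κ(εu + t) = D_κ(u + εt)` (`κ ≠ α`). [folklore] -/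
theorem fwdDelta_reflect_ne {α κ : Fin d} (h : κ ≠ α) (u t : Beta.Site d s) :
    fwdDelta κ (torusAxisReflect α u + t) = fwdDelta κ (u + torusAxisReflect α t) := by
  unfold fwdDelta
  rw [← delta0_torusAxisReflect α (torusAxisReflect α u + t + torusUnitVec κ),
    ← delta0_torusAxisReflect α (torusAxisReflect α u + t)]
  simp only [torusAxisReflect_add, torusAxisReflect_torusAxisReflect, torusAxisReflect_torusUnitVec_ne h]

omit [NeZero s] in
/-- REFLECTION OF THE FORWARD DIFFERENCE along the reflected axis: `D_α(εu + t) = −D_α(u + εt − ê_α)` (a forward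
difference reflects into minus the forward difference at the shifted site — the bond `⟨x, x+ê_α⟩` maps to the bond
`⟨rx − ê_α, rx⟩` with reversed orientation, cf. [Balaban1987RG1] (5.7) p. 293). [folklore] -/
theorem fwdDelta_reflect_self (α : Fin d) (u t : Beta.Site d s) :
    fwdDelta α (torusAxisReflect α u + t) = -fwdDelta α (u + torusAxisReflect α t - torusUnitVec α) := by
  unfold fwdDelta
  rw [← delta0_torusAxisReflect α (torusAxisReflect α u + t + torusUnitVec α),
    ← delta0_torusAxisReflect α (torusAxisReflect α u + t)]
  simp only [torusAxisReflect_add, torusAxisReflect_torusAxisReflect, torusAxisReflect_torusUnitVec_self,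
    sub_add_cancel, ← sub_eq_add_neg]
  ring

omit [NeZero s] in
/-- Uniform form: `D_κ(εu − [κ=α]ê_α) = ε_κ D_κ(u)`. [folklore] -/
theorem fwdDelta_reflect (α κ : Fin d) (u : Beta.Site d s) :
    fwdDelta κ (torusAxisReflect α u - (if κ = α then torusUnitVec α else 0)) = reflSign α κ * fwdDelta κ u := by
  by_cases h : κ = α
  · subst h
    have := fwdDelta_reflect_self κ u (-torusUnitVec κ)
    rw [torusAxisReflect_neg, torusAxisReflect_torusUnitVec_self, neg_neg, add_sub_cancel_right,
      ← sub_eq_add_neg] at this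
    rw [if_pos rfl, this, reflSign_self]; ring
  · have := fwdDelta_reflect_ne h u 0
    rw [add_zero, torusAxisReflect_zero, add_zero] at this
    rw [if_neg h, sub_zero, this, reflSign_of_ne h, one_mul]

/-- THE PLAQUETTE-CURL INCIDENCE: row index `ρ = (κ, λ)` (an ordered pair of directions), and
`(T A)_{(κ,λ)}(w) = (∂_κ A_λ)(w) − (∂_λ A_κ)(w)` — the lattice field strength of the plaquette at `w` in the
`κλ`-plane (zero for `κ = λ`, antisymmetric).  As a convolution tensor: `a_{(κ,λ)μ}(u) = [μ=λ] D_κ(u) − [μ=κ] D_λ(u)`.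
[folklore] -/
def curlInc (ρ : Fin d × Fin d) (μ : Fin d) (u : Beta.Site d s) : ℝ :=
  (if μ = ρ.2 then fwdDelta ρ.1 u else 0) - (if μ = ρ.1 then fwdDelta ρ.2 u else 0)

/-- `(T A)_{(κ,λ)}(w) = [A_λ(w + ê_κ) − A_λ(w)] − [A_κ(w + ê_λ) − A_κ(w)]` — `incApply curlInc` IS the plaquette
curl. [folklore] -/
theorem incApply_curlInc (A : Beta.Site d s → Fin d → ℝ) (w : Beta.Site d s) (κ τ : Fin d) :
    incApply curlInc A w (κ, τ)
      = (A (w + torusUnitVec κ) τ - A w τ) - (A (w + torusUnitVec τ) κ - A w κ) := by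
  unfold incApply curlInc
  simp only [sub_mul, Finset.sum_sub_distrib, ite_mul, zero_mul, Finset.sum_ite_eq', Finset.mem_univ, if_true,
    sum_fwdDelta_sub_mul]

/-- **THE TREE-LEVEL LATTICE MAXWELL KERNEL** on the torus `(ZMod s)^d`: the Gram kernel of the plaquette curl,
i.e. the convolution kernel of the Hessian of `A ↦ ½ Σ_w Σ_{(κ,λ)} ((∂_κ A_λ − ∂_λ A_κ)(w))²` (the quadratic part
of the Wilson action at `g = 0`, in Feynman–'t Hooft-free form). [folklore] -/
def maxwellKernel (d s : ℕ) [NeZero s] : Fin d → Fin d → Beta.Site d s → ℝ :=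
  gramKernel (curlInc (d := d) (s := s))

omit [NeZero s] in
/-- The curl rows are divergence free: `Σ_μ [a_{(κ,λ)μ}(u + ê_μ) − a_{(κ,λ)μ}(u)] = 0` (`∂_λ ∂_κ = ∂_κ ∂_λ`).
[folklore] -/
theorem divFree_curlInc : DivFree (curlInc (d := d) (s := s)) := by
  rintro ⟨κ, τ⟩ u
  simp only [curlInc, Finset.sum_sub_distrib, Finset.sum_ite_eq', Finset.mem_univ, if_true, fwdDelta]
  rw [show u + torusUnitVec τ + torusUnitVec κ = u + torusUnitVec κ + torusUnitVec τ from add_right_comm _ _ _]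
  ring

omit [NeZero s] in
/-- The curl rows are reflection covariant, with row sign `σ_{(κ,λ)} = ε_κ ε_λ` and row shift
`c_{(κ,λ)} = −[κ=α]ê_α − [λ=α]ê_α`. [folklore] -/
theorem rowReflCovariant_curlInc : RowReflCovariant (curlInc (d := d) (s := s)) := by
  intro α
  refine ⟨fun ρ => -(if ρ.1 = α then torusUnitVec α else 0) - (if ρ.2 = α then torusUnitVec α else 0),
    fun ρ => reflSign α ρ.1 * reflSign α ρ.2, fun ρ => ?_, ?_⟩
  · calc reflSign α ρ.1 * reflSign α ρ.2 * (reflSign α ρ.1 * reflSign α ρ.2)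
        = (reflSign α ρ.1 * reflSign α ρ.1) * (reflSign α ρ.2 * reflSign α ρ.2) := by ring
      _ = 1 := by rw [reflSign_mul_self, reflSign_mul_self, mul_one]
  rintro ⟨κ, τ⟩ μ u
  simp only [curlInc]
  have e1 : (if μ = τ then fwdDelta κ (torusAxisReflect α u
        + (-(if κ = α then torusUnitVec α else 0) - (if τ = α then torusUnitVec α else 0))
        + (if μ = α then torusUnitVec α else 0)) else 0)
      = if μ = τ then reflSign α κ * fwdDelta κ u else 0 := by
    by_cases hμ : μ = τ
    · rw [if_pos hμ, if_pos hμ, ← fwdDelta_reflect α κ u, hμ]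
      congr 1; abel
    · rw [if_neg hμ, if_neg hμ]
  have e2 : (if μ = κ then fwdDelta τ (torusAxisReflect α u
        + (-(if κ = α then torusUnitVec α else 0) - (if τ = α then torusUnitVec α else 0))
        + (if μ = α then torusUnitVec α else 0)) else 0)
      = if μ = κ then reflSign α τ * fwdDelta τ u else 0 := by
    by_cases hμ : μ = κ
    · rw [if_pos hμ, if_pos hμ, ← fwdDelta_reflect α τ u, hμ]
      congr 1; abel
    · rw [if_neg hμ, if_neg hμ]
  rw [e1, e2]
  have hκκ := reflSign_mul_self α κ
  have hττ := reflSign_mul_self α τ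
  by_cases hμτ : μ = τ
  · subst hμτ
    by_cases hμκ : μ = κ
    · subst hμκ; simp
    · rw [if_pos rfl, if_neg hμκ, if_pos rfl, if_neg hμκ]
      linear_combination (-(reflSign α κ * fwdDelta κ u)) * hττ
  · by_cases hμκ : μ = κ
    · subst hμκ
      rw [if_neg hμτ, if_pos rfl, if_neg hμτ, if_pos rfl]
      linear_combination (reflSign α τ * fwdDelta τ u) * hκκ
    · simp [hμτ, hμκ]

/-- **THE MAXWELL KERNEL SATISFIES ALL FOUR TORUS-SIDE HYPOTHESES OF THE SIGN LEMMA**, for every `d` and every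
period `s`: Ward/transversality (5.9)-shape, reflection covariance (5.7)-shape, index symmetry (5.8)-shape, and
positive semi-definiteness. [folklore] -/
theorem maxwellKernel_hypotheses (d s : ℕ) [NeZero s] :
    TorusWardTransversal (maxwellKernel d s) ∧ TorusAxisReflectionCovariant (maxwellKernel d s)
      ∧ TorusIndexSymmetric (maxwellKernel d s) ∧ TorusConvPSD (maxwellKernel d s) :=
  ⟨torusWardTransversal_gram divFree_curlInc, torusAxisReflectionCovariant_gram rowReflCovariant_curlInc,
    torusIndexSymmetric_gram _, torusConvPSD_gram _⟩

/-! ## §5 The closed form of the Maxwell kernel and the finite-volume second moment `β_T = 2` -/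

/-- The difference–difference correlator `C_{νμ}(z) = Σ_u D_ν(u) D_μ(u + z)` in closed form:
`δ(z + ê_μ − ê_ν) − δ(z − ê_ν) − δ(z + ê_μ) + δ(z)`. [folklore] -/
def ddCorr (ν μ : Fin d) (z : Beta.Site d s) : ℝ :=
  delta0 (z + torusUnitVec μ - torusUnitVec ν) - delta0 (z - torusUnitVec ν) - delta0 (z + torusUnitVec μ) + delta0 z

/-- `Σ_u D_ν(u) D_μ(u + z) = C_{νμ}(z)`. [folklore] -/
theorem sum_fwdDelta_mul_fwdDelta (ν μ : Fin d) (z : Beta.Site d s) :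
    ∑ u, fwdDelta ν u * fwdDelta μ (u + z) = ddCorr ν μ z := by
  have h1 : ∀ u : Beta.Site d s, fwdDelta ν u * fwdDelta μ (u + z)
      = delta0 (u + torusUnitVec ν) * fwdDelta μ (u + z) - delta0 (u + 0) * fwdDelta μ (u + z) := by
    intro u; rw [fwdDelta, add_zero]; ring
  simp only [h1, Finset.sum_sub_distrib, sum_delta0_add_mul]
  simp only [neg_zero, zero_add, fwdDelta, ddCorr]
  have e : -torusUnitVec ν + z + torusUnitVec μ = z + torusUnitVec μ - torusUnitVec ν := by abel
  rw [e, show -torusUnitVec ν + z = z - torusUnitVec ν from by abel]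
  ring

omit [NeZero s] in
/-- The row sum of the curl Gram kernel at fixed `u`:
`Σ_{(κ,λ)} a_{(κ,λ)μ}(u) a_{(κ,λ)ν}(u + z) = 2 ( [μ=ν] Σ_κ D_κ(u) D_κ(u+z) − D_ν(u) D_μ(u+z) )`. [folklore] -/
theorem sum_curlInc_mul_curlInc (μ ν : Fin d) (u z : Beta.Site d s) :
    ∑ ρ : Fin d × Fin d, curlInc ρ μ u * curlInc ρ ν (u + z)
      = 2 * ((if μ = ν then ∑ κ, fwdDelta κ u * fwdDelta κ (u + z) else 0)
          - fwdDelta ν u * fwdDelta μ (u + z)) := by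
  rw [Fintype.sum_prod_type]
  simp only [curlInc, sub_mul, mul_sub, ite_mul, mul_ite, zero_mul, mul_zero, Finset.sum_sub_distrib,
    Finset.sum_ite_eq, Finset.mem_univ, if_true, Finset.sum_ite_irrel, Finset.sum_const_zero]
  by_cases h : μ = ν
  · subst h; simp only [if_true]; ring
  · repeat rw [if_neg h]
    ring

/-- **THE MAXWELL KERNEL IN CLOSED FORM**: `Π_{μν}(z) = 2 ( δ_{μν} Σ_κ C_{κκ}(z) − C_{νμ}(z) )`, i.e.
`Π_{μμ} = 2 Σ_{κ≠μ} (2δ(z) − δ(z + ê_κ) − δ(z − ê_κ))` (minus the lattice Laplacian transverse to `μ`, doubled) and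
`Π_{μν}(z) = −2 [δ(z + ê_μ − ê_ν) − δ(z − ê_ν) − δ(z + ê_μ) + δ(z)]` for `μ ≠ ν` (the mixed second difference
`2 ∂_μ ∂_ν^*`): the familiar `−Δ δ_{μν} + ∂_μ ∂_ν^*` structure of the free lattice Maxwell operator (up to the
factor `2` from counting both orderings `(κ,λ)`, `(λ,κ)` of each plaquette). [folklore] -/
theorem maxwellKernel_apply (μ ν : Fin d) (z : Beta.Site d s) :
    maxwellKernel d s μ ν z = 2 * ((if μ = ν then ∑ κ, ddCorr κ κ z else 0) - ddCorr ν μ z) := by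
  unfold maxwellKernel gramKernel
  simp only [sum_curlInc_mul_curlInc, ← Finset.mul_sum, Finset.sum_sub_distrib, sum_fwdDelta_mul_fwdDelta]
  congr 2
  split_ifs with h
  · rw [Finset.sum_comm]
    exact Finset.sum_congr rfl fun κ _ => sum_fwdDelta_mul_fwdDelta κ κ z
  · simp

/-- Off-diagonal entries: `Π_{μν}(z) = −2 C_{νμ}(z) = −2 [δ(z + ê_μ − ê_ν) − δ(z − ê_ν) − δ(z + ê_μ) + δ(z)]`
(`μ ≠ ν`). [folklore] -/
theorem maxwellKernel_offdiag_closed {μ ν : Fin d} (hμν : μ ≠ ν) (z : Beta.Site d s) :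
    maxwellKernel d s μ ν z = -2 * (delta0 (z + torusUnitVec μ - torusUnitVec ν) - delta0 (z - torusUnitVec ν)
      - delta0 (z + torusUnitVec μ) + delta0 z) := by
  rw [maxwellKernel_apply, if_neg hμν, ddCorr]; ring

/-- The window representatives of `0, ±1` (period `s ≥ 3`). [folklore] -/
theorem symmRep_one (hs : 3 ≤ s) : symmRep s (1 : ZMod s) = 1 := by
  have h : InWindow s 1 := by constructor <;> omega
  simpa using symmRep_intCast h

/-- [folklore] -/
theorem symmRep_neg_one (hs : 3 ≤ s) : symmRep s (-1 : ZMod s) = -1 := by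
  have h : InWindow s (-1) := by constructor <;> omega
  have := symmRep_intCast h
  simpa using this

/-- [folklore] -/
theorem symmRep_zero' : symmRep s (0 : ZMod s) = 0 := by
  simp [symmRep]

/-- **THE FINITE-VOLUME SECOND MOMENT OF THE MAXWELL KERNEL IS `2`**: `Σ_{x∈T} Π_{μν}(x) x_μ x_ν = 2` for
`μ ≠ ν` and every period `s ≥ 3` (window representatives; only `x = ê_ν − ê_μ` contributes, with
`x_μ x_ν = (−1)(+1)` and weight `−2`).  In particular the conclusion `β ≥ 0` of the sign lemma is attained with
STRICT inequality by a kernel satisfying all its hypotheses: the hypotheses are jointly satisfiable and do not force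
`β = 0`. [folklore] -/
theorem torusSecondMoment_maxwellKernel (hs : 3 ≤ s) {μ ν : Fin d} (hμν : μ ≠ ν) :
    torusSecondMoment (maxwellKernel d s) μ ν = 2 := by
  unfold torusSecondMoment
  simp only [maxwellKernel_offdiag_closed hμν]
  have key : ∀ x : Beta.Site d s,
      -2 * (delta0 (x + torusUnitVec μ - torusUnitVec ν) - delta0 (x - torusUnitVec ν) - delta0 (x + torusUnitVec μ)
        + delta0 x) * (symmRep s (x μ) : ℝ) * (symmRep s (x ν) : ℝ)
      = -2 * (delta0 (x - (torusUnitVec ν - torusUnitVec μ)) * ((symmRep s (x μ) : ℝ) * (symmRep s (x ν) : ℝ)))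
        + 2 * (delta0 (x - torusUnitVec ν) * ((symmRep s (x μ) : ℝ) * (symmRep s (x ν) : ℝ)))
        + 2 * (delta0 (x - (-torusUnitVec μ)) * ((symmRep s (x μ) : ℝ) * (symmRep s (x ν) : ℝ)))
        - 2 * (delta0 (x - 0) * ((symmRep s (x μ) : ℝ) * (symmRep s (x ν) : ℝ))) := by
    intro x
    rw [show x - (torusUnitVec ν - torusUnitVec μ) = x + torusUnitVec μ - torusUnitVec ν from by abel,
      show x - (-torusUnitVec μ) = x + torusUnitVec μ from by abel, sub_zero]
    ring
  simp only [key, Finset.sum_sub_distrib, Finset.sum_add_distrib, ← Finset.mul_sum, sum_delta0_sub_mul]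
  simp [hμν, hμν.symm, symmRep_one hs, symmRep_neg_one hs, symmRep_zero']

end Literature.MathematicalPhysics.QuantumFieldTheory.Balaban1983to89.Beta.PolarizationWitness
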